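import Summits.BirchSwinnertonDyer.BirchSwinnertonDyer.Theorems.CyclotomicUntwistPSTwistInvolution
import Summits.BirchSwinnertonDyer.BirchSwinnertonDyer.Theorems.CyclotomicUntwistGNineRows
import Summits.BirchSwinnertonDyer.Rank1Residual.GaloisImage.JWitnessTowerSurjectivity
import Summits.BirchSwinnertonDyer.Rank1Residual.Additive.QuadraticTwistSurj
import Summits.BirchSwinnertonDyer.Rank1Residual.AdditivePotMult.Twist
import Literature.NumberTheory.EllipticCurves.ComplexMultiplicationHasCMProofs
import HarnessLib

/-!
# LAW L-tw3, image layer: the Galois-image binders of K1/K2/X3 (`ρ̄₃` onto, the `3`-adic tower,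
# `¬CM`) and the structural hypothesis `(G₉)` are carried across the `χ₋₃`-twist pair — the
# principal-series row set of route `CyclotomicUntwist` is involution-stable in every binder except
# the analytic rank

Cell `pub/bsd-wall` (D-0145 line `route-BirchSwinnertonDyer-CyclotomicUntwist`), seat `bsd-line-cycu-p4`
(width seat 4, gen 6). Helper toward the cruxes K1 `PSRankOneLowerHalfAtThree`
(stmt-BirchSwinnertonDyer-21580) and K2 `PSRankOneUpperHalfAtThree` (stmt-21581). THEOREMS ONLY (no
definition, no named fact, no `sorry`); BSD is not proved by this file and no crux is. Fifth file of LAW L-tw3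
(`…PSTwistInvolutionKodaira` Kodaira layer, `…UnitPart` PS ↦ PS and `W₃ ↦ −W₃`, `…PSTwistInvolution`
dictionary / conductor / symmetry, `…Character` `η = η⁴·η³`). The summary `twist_involution_of_psRow` of
file 3 left «analytic rank and `ρ̄₃` not claimed preserved»; this file settles `ρ̄₃` (and more) BY NAME from
the tree's twist-invariance of Galois images:

* §12 (any `V/ℚ`, any `d ≠ 0`, any `ℚ`-model `C • V^{(d)} = W`, any prime `p`): `surj_twist_iff`
  (`Surj W p ↔ Surj V p`, tree `Additive.surj_iff_of_model_twist`), **`towerSurj_twist_iff`** /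
  `forall_towerSurj_twist_iff` (`ρ̄_{W,pⁿ}` onto ↔ `ρ̄_{V,pⁿ}` onto for every `n`, tree
  `GaloisImage.hasSurjectiveModNGaloisRep_pow_iff_of_model_twist`: `E^{(d)}[m] ≅ E[m] ⊗ χ_d` and `−1` is a
  square in the image), `irr_twist_iff`, `hasCM_twist_iff` (same `j`).
* §13 (cyclic wild cell at `3`: `ClassO6 V 3`, `v₃Δ_min(V)` even; `d = ±3`; `W` globally minimal):
  **`typeGNine_twist_iff_of_cyclic`** — Delbourgo's `(G₉)` (`TypeGNine`, the structural hypothesis of the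
  registered K1 stubs) holds for `W` iff for `V`: on the cyclic cell `(G₉)` ⟺ `v` even ∧ `Δ_min/3^v ≡ 1 (mod 3)`
  (tree `GNineConverse.typeGNine_iff_even_and_mod_three_eq_one` = `GNineCriterion` + its converse) and the unit
  part mod `3` is a twist invariant (file 2).
* §14 **`psSurjRow_twist_of_psSurjRow`**: the full antecedent of K1/K2 minus the analytic rank —
  `¬CM ∧ ClassO6 ∧ Surj 3 ∧ v even ∧ Δ′ ≡ 1 (mod 3)` — passes from `V` to `W`;
  **`gNineTowerRow_twist_of_gNineTowerRow`**: so does the antecedent `¬CM ∧ ClassO6 ∧ Surj 3 ∧ (G₉) ∧ tower`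
  of the registered stub `stub_rung_lowerHalfOnGNine_towerUnit` minus its Tamagawa clause;
  `binders_twist_iff_of_cyclic` (all seven equivalences at once) and the refreshed summary
  **`twist_involution_of_psSurjRow`** (PS row ↦ PS row, `Surj`/tower/`¬CM`/`(G₉)` kept, Kraus order `3 ↔ 6`,
  `W₃ ↦ −W₃`, `N` fixed), plus `exists_psSurjRow_partner` (every K1/K2 row HAS such a partner row).

NOT transported, on purpose: `analyticRank` (the partner's rank is unrelated), and `3 ∣ ∏ c_ℓ` (at `ℓ = 3`
the factor `c₃ = 3` lives on the `IV`/`IV*` side only, file 3; at a multiplicative `ℓ` with `χ₋₃(ℓ) = −1`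
split and non-split are exchanged). So the involution acts on the ROW SET of K1/K2 and on the row set of the
tower rung, not on the statements K1/K2 themselves.

References: J.-P. Serre, Invent. Math. 15 (1972) §2 [Serre1972]; J. H. Silverman, *AEC* (2009) X.2 Prop. 2.4,
X.5 Cor. 5.4, III.1 Prop. 1.4 [SilvermanAEC2009]; A. Kraus, Manuscripta Math. 69 (1990) [Kraus1990];
D. Delbourgo, Compositio Math. 113 (1998) §1.5 (G) [Delbourgo1998].
-/

open scoped Classical

open WeierstrassCurve IsDedekindDomain Rat.HeightOneSpectrum Literature.NumberTheory.EllipticCurves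
  Literature.NumberTheory.EllipticCurves.Rank1Residual Literature.NumberTheory.DiophantineGeometry
  Summit.BirchSwinnertonDyer.Rank1Residual.Additive

set_option linter.dupNamespace false -- single-conjunct summit: the name repeats by design
set_option autoImplicit false

namespace Summit.BirchSwinnertonDyer.BirchSwinnertonDyer.Theorems.PSTwistInvolution

/-! ### §12 Galois-image binders across ANY quadratic twist (model-free, any prime) -/

section Image

variable (V W : WeierstrassCurve ℚ) [V.IsElliptic] [W.IsElliptic] (p : ℕ) [Fact p.Prime]

omit [W.IsElliptic] in
/-- **`ρ̄_{E,p}` onto is a twist invariant** on any `ℚ`-model `W` of `V^{(d)}` (`C • V^{(d)} = W`, `d ≠ 0`):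
`E^{(d)}[p] ≅ E[p] ⊗ χ_d`, the images agree up to the central sign and `−1` is a square in the image (tree
`Additive.surj_iff_of_model_twist`). [cite: SilvermanAEC2009, X.5 Cor. 5.4] [cite: Serre1972, §2.4–§2.6] -/
theorem surj_twist_iff {d : ℚ} (hd : d ≠ 0) (C : VariableChange ℚ) (hC : C • V.quadraticTwist d = W) :
    Surj W p ↔ Surj V p :=
  Summit.BirchSwinnertonDyer.Rank1Residual.Additive.surj_iff_of_model_twist V p hd ⟨C, hC⟩

omit [W.IsElliptic] in
/-- **Every level of the `p`-adic tower is a twist invariant**: `ρ̄_{W,pⁿ}` onto ↔ `ρ̄_{V,pⁿ}` onto for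
`C • V^{(d)} = W` (tree `GaloisImage.hasSurjectiveModNGaloisRep_pow_iff_of_model_twist`: the twisting
isomorphism `E[pⁿ] ≃ E^{(d)}[pⁿ]` is `Γ_ℚ`-equivariant up to sign and `−1 = J²` is a square in `Aut E[pⁿ]`).
[cite: SilvermanAEC2009, X.5 Cor. 5.4] [cite: Serre1972, §2] -/
theorem towerSurj_twist_iff {d : ℚ} (hd : d ≠ 0) (C : VariableChange ℚ)
    (hC : C • V.quadraticTwist d = W) (n : ℕ) :
    W.HasSurjectiveModNGaloisRep (p ^ n : ℕ) ↔ V.HasSurjectiveModNGaloisRep (p ^ n : ℕ) :=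
  Summit.BirchSwinnertonDyer.Rank1Residual.GaloisImage.hasSurjectiveModNGaloisRep_pow_iff_of_model_twist
    V p hd ⟨C, hC⟩ n

omit [W.IsElliptic] in
/-- **The whole `p`-adic tower is a twist invariant** (`∀ n`, `ρ̄_{·,pⁿ}` onto).
[cite: SilvermanAEC2009, X.5 Cor. 5.4] [cite: Serre1972, §2] -/
theorem forall_towerSurj_twist_iff {d : ℚ} (hd : d ≠ 0) (C : VariableChange ℚ)
    (hC : C • V.quadraticTwist d = W) :
    (∀ n : ℕ, W.HasSurjectiveModNGaloisRep (p ^ n : ℕ)) ↔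
      ∀ n : ℕ, V.HasSurjectiveModNGaloisRep (p ^ n : ℕ) :=
  forall_congr' fun n ↦ towerSurj_twist_iff V W p hd C hC n

/-- **`E[p]` irreducible is a twist invariant** (Galois-stable lines correspond under the sign-twisted
isomorphism; tree `AdditivePotMult.irr_iff_of_model_twist`). [cite: SilvermanAEC2009, X.5 Cor. 5.4] -/
theorem irr_twist_iff {d : ℚ} (hd : d ≠ 0) (C : VariableChange ℚ) (hC : C • V.quadraticTwist d = W) :
    Irr W p ↔ Irr V p :=
  Summit.BirchSwinnertonDyer.Rank1Residual.AdditivePotMult.irr_iff_of_model_twist (W := V) (p := p) hd ⟨C, hC⟩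

omit [Fact p.Prime] in
/-- **CM is a twist invariant** (`j(C • V^{(d)}) = j(V)` and CM is read off `j`, tree `hasCM_iff_of_j_eq`).
[cite: SilvermanAEC2009, X.5 Cor. 5.4 and III.1 Prop. 1.4(b)] -/
theorem hasCM_twist_iff {d : ℚ} (hd : d ≠ 0) (C : VariableChange ℚ) (hC : C • V.quadraticTwist d = W) :
    W.HasCM ↔ V.HasCM := by
  haveI := V.isElliptic_quadraticTwist hd
  subst hC
  exact hasCM_iff_of_j_eq (by rw [variableChange_j, V.j_quadraticTwist hd])

end Image

/-! ### §13 `(G₉)` across the twist on the cyclic wild cell -/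

section GNine

variable (V W : WeierstrassCurve ℚ) [V.IsElliptic] [V.IsGloballyMinimal] [W.IsElliptic] [W.IsGloballyMinimal]

/-- **A PS row's partner is of type `(G₉)`**: `V` on a PS row (`ClassO6`, `v` even, `Δ′ ≡ 1`), `d = ±3`,
`C • V^{(d)} = W` globally minimal ⟹ `TypeGNine W` (PS ↦ PS, then `GNineCriterion`).
[cite: Kraus1990, Théorème 1 (p = 3)] [cite: Delbourgo1998, §1.5 (G)] -/
theorem typeGNine_twist_of_psRow (hO6 : ClassO6 V 3) (hev : Even (padicValInt 3 V.minimalDiscriminantInt))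
    (hps : V.minimalDiscriminantInt / 3 ^ padicValInt 3 V.minimalDiscriminantInt % 3 = 1)
    {d : ℤ} (hd : d = 3 ∨ d = -3) (C : VariableChange ℚ) (hC : C • V.quadraticTwist (d : ℚ) = W) :
    TypeGNine W := by
  obtain ⟨hO6W, hevW, hpsW⟩ := psRow_twist_of_psRow V W hO6 hev hps hd C hC
  exact (GNineConverse.typeGNine_iff_even_and_mod_three_eq_one W hO6W).mpr ⟨hevW, hpsW⟩

/-- **`(G₉)` is a twist invariant on the cyclic wild cell**: `ClassO6 V 3`, `v₃Δ_min(V)` even, `d = ±3`,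
`C • V^{(d)} = W` globally minimal ⟹ (`TypeGNine W ↔ TypeGNine V`) — both sides are the unit-part
condition (tree `GNineConverse.typeGNine_iff_even_and_mod_three_eq_one`: `GNineCriterion` and its converse) and
`Δ′(W) ≡ Δ′(V) (mod 3)`
(`minimalDiscUnitPartThree_twist_emod_three`). [cite: Kraus1990, Théorème 1 (p = 3)] [cite: Delbourgo1998, §1.5 (G)] -/
theorem typeGNine_twist_iff_of_cyclic (hO6 : ClassO6 V 3) (hev : Even (padicValInt 3 V.minimalDiscriminantInt))
    {d : ℤ} (hd : d = 3 ∨ d = -3) (C : VariableChange ℚ) (hC : C • V.quadraticTwist (d : ℚ) = W) :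
    TypeGNine W ↔ TypeGNine V := by
  have hO6W := classO6_twist_of_cyclic W V hO6 hev hd C hC
  have hevW := even_twist_of_cyclic V W hO6 hev hd C hC
  rw [GNineConverse.typeGNine_iff_even_and_mod_three_eq_one W hO6W,
    GNineConverse.typeGNine_iff_even_and_mod_three_eq_one V hO6,
    minimalDiscUnitPartThree_twist_emod_three V W hd C hC]
  exact ⟨fun h ↦ ⟨hev, h.2⟩, fun h ↦ ⟨hevW, h.2⟩⟩

end GNine

/-! ### §14 The K1/K2 binders, packaged -/

section Binders

variable (V W : WeierstrassCurve ℚ) [V.IsElliptic] [V.IsGloballyMinimal] [W.IsElliptic] [W.IsGloballyMinimal]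

/-- **All binders at once** on the cyclic wild cell (`ClassO6 V 3`, `v₃Δ_min(V)` even, `d = ±3`,
`C • V^{(d)} = W` globally minimal): `W` is again on the cyclic cell, and CM, `ρ̄₃` onto, every level of the
`3`-adic tower, `E[3]` irreducible, the unit-part condition and `(G₉)` hold for `W` iff they hold for `V`.
[cite: SilvermanAEC2009, X.5 Cor. 5.4] [cite: Kraus1990, Théorème 1 (p = 3)] -/
theorem binders_twist_iff_of_cyclic (hO6 : ClassO6 V 3) (hev : Even (padicValInt 3 V.minimalDiscriminantInt))
    {d : ℤ} (hd : d = 3 ∨ d = -3) (C : VariableChange ℚ) (hC : C • V.quadraticTwist (d : ℚ) = W) :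
    ClassO6 W 3 ∧ Even (padicValInt 3 W.minimalDiscriminantInt) ∧ (W.HasCM ↔ V.HasCM) ∧
      (Surj W 3 ↔ Surj V 3) ∧ (∀ n : ℕ, W.HasSurjectiveModNGaloisRep (3 ^ n : ℕ) ↔
        V.HasSurjectiveModNGaloisRep (3 ^ n : ℕ)) ∧ (Irr W 3 ↔ Irr V 3) ∧
      (W.minimalDiscriminantInt / 3 ^ padicValInt 3 W.minimalDiscriminantInt % 3 = 1 ↔
        V.minimalDiscriminantInt / 3 ^ padicValInt 3 V.minimalDiscriminantInt % 3 = 1) ∧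
      (TypeGNine W ↔ TypeGNine V) := by
  haveI : Fact (Nat.Prime 3) := ⟨Nat.prime_three⟩
  have hd0 := cast_ne_zero_of_pm_three hd
  exact ⟨classO6_twist_of_cyclic W V hO6 hev hd C hC, even_twist_of_cyclic V W hO6 hev hd C hC,
    hasCM_twist_iff V W hd0 C hC, surj_twist_iff V W 3 hd0 C hC,
    fun n ↦ towerSurj_twist_iff V W 3 hd0 C hC n, irr_twist_iff V W 3 hd0 C hC,
    by rw [minimalDiscUnitPartThree_twist_emod_three V W hd C hC],
    typeGNine_twist_iff_of_cyclic V W hO6 hev hd C hC⟩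

/-- **The K1/K2 antecedent minus the analytic rank passes to the partner.** For `V` with `¬CM`, `ClassO6 V 3`,
`ρ̄_{V,3}` onto, `v₃Δ_min(V)` even, `Δ_min/3^v ≡ 1 (mod 3)` — the hypotheses of `PSRankOneLowerHalfAtThree` /
`PSRankOneUpperHalfAtThree` except `analyticRank = 1` — and `d = ±3`, `C • V^{(d)} = W` globally minimal:
`W` satisfies the same five hypotheses. [cite: SilvermanAEC2009, X.5 Cor. 5.4] [cite: Kraus1990, Théorème 1 (p = 3)] -/
theorem psSurjRow_twist_of_psSurjRow (hCM : ¬ V.HasCM) (hO6 : ClassO6 V 3) (hsurj : Surj V 3)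
    (hev : Even (padicValInt 3 V.minimalDiscriminantInt))
    (hps : V.minimalDiscriminantInt / 3 ^ padicValInt 3 V.minimalDiscriminantInt % 3 = 1)
    {d : ℤ} (hd : d = 3 ∨ d = -3) (C : VariableChange ℚ) (hC : C • V.quadraticTwist (d : ℚ) = W) :
    ¬ W.HasCM ∧ ClassO6 W 3 ∧ Surj W 3 ∧ Even (padicValInt 3 W.minimalDiscriminantInt) ∧
      W.minimalDiscriminantInt / 3 ^ padicValInt 3 W.minimalDiscriminantInt % 3 = 1 := by
  obtain ⟨hO6W, hevW, hCMi, hSi, -, -, hpsi, -⟩ := binders_twist_iff_of_cyclic V W hO6 hev hd C hC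
  exact ⟨fun h ↦ hCM (hCMi.mp h), hO6W, hSi.mpr hsurj, hevW, hpsi.mpr hps⟩

/-- **The antecedent of the registered tower rung minus its Tamagawa clause passes to the partner.** For `V`
with `¬CM`, `ClassO6 V 3`, `ρ̄_{V,3}` onto, `(G₉)` and `ρ̄_{V,3ⁿ}` onto for all `n` (the binders of
`stub_rung_lowerHalfOnGNine_towerUnit` / `stub_upperHalf_tower` other than `3 ∤ ∏ c_ℓ` and the rank) and
`d = ±3`, `C • V^{(d)} = W` globally minimal: `W` satisfies the same. (`v₃Δ_min(V)` is even by `(G₉)`,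
tree `GNineCriterion.even_padicValInt_minimalDiscriminantInt_of_typeGNine`.) The clause `3 ∤ ∏ c_ℓ` is NOT a twist
invariant (`c₃`: `1 ↔ 3` is possible on `II*/II ↔ IV/IV*`). [cite: Kraus1990, Théorème 1 (p = 3)]
[cite: SilvermanAEC2009, X.5 Cor. 5.4] -/
theorem gNineTowerRow_twist_of_gNineTowerRow (hCM : ¬ V.HasCM) (hO6 : ClassO6 V 3) (hsurj : Surj V 3)
    (hG : TypeGNine V) (htower : ∀ n : ℕ, V.HasSurjectiveModNGaloisRep (3 ^ n : ℕ))
    {d : ℤ} (hd : d = 3 ∨ d = -3) (C : VariableChange ℚ) (hC : C • V.quadraticTwist (d : ℚ) = W) :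
    ¬ W.HasCM ∧ ClassO6 W 3 ∧ Surj W 3 ∧ TypeGNine W ∧
      ∀ n : ℕ, W.HasSurjectiveModNGaloisRep (3 ^ n : ℕ) := by
  have hev := GNineCriterion.even_padicValInt_minimalDiscriminantInt_of_typeGNine V hG
  obtain ⟨hO6W, -, hCMi, hSi, hTi, -, -, hGi⟩ := binders_twist_iff_of_cyclic V W hO6 hev hd C hC
  exact ⟨fun h ↦ hCM (hCMi.mp h), hO6W, hSi.mpr hsurj, hGi.mpr hG, fun n ↦ (hTi n).mpr (htower n)⟩

/-- **LAW L-tw3, refreshed summary on the rows of K1/K2 (`d = −3`).** For `V` satisfying the antecedent of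
`PSRankOneLowerHalfAtThree` / `PSRankOneUpperHalfAtThree` minus the rank (`¬CM`, `ClassO6 V 3`, `ρ̄₃` onto,
`v := v₃Δ_min(V)` even, `Δ_min/3^v ≡ 1 (mod 3)`) and a globally minimal `W` with `C • V^{(−3)} = W`:
`W` satisfies the same five hypotheses; the `3`-adic tower and `(G₉)` hold for `W` iff for `V`;
`v₃Δ_min(W) = v + 6` (`v ≤ 6`) or `v − 6`; Kraus's inertia order is `3` on one side and `6` on the other;
`W₃(W) = −W₃(V)`; `N(W) = N(V)`. Only the analytic rank is not related.
[cite: Kraus1990, Théorème (p = 3)] [cite: SilvermanAEC2009, X.5 Cor. 5.4 and C.16] [cite: Serre1972, §2] -/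
theorem twist_involution_of_psSurjRow (hCM : ¬ V.HasCM) (hO6 : ClassO6 V 3) (hsurj : Surj V 3)
    (hev : Even (padicValInt 3 V.minimalDiscriminantInt))
    (hps : V.minimalDiscriminantInt / 3 ^ padicValInt 3 V.minimalDiscriminantInt % 3 = 1)
    (C : VariableChange ℚ) (hC : C • V.quadraticTwist ((-3 : ℤ) : ℚ) = W) :
    (¬ W.HasCM ∧ ClassO6 W 3 ∧ Surj W 3 ∧ Even (padicValInt 3 W.minimalDiscriminantInt) ∧
        W.minimalDiscriminantInt / 3 ^ padicValInt 3 W.minimalDiscriminantInt % 3 = 1) ∧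
      ((∀ n : ℕ, W.HasSurjectiveModNGaloisRep (3 ^ n : ℕ)) ↔
        ∀ n : ℕ, V.HasSurjectiveModNGaloisRep (3 ^ n : ℕ)) ∧
      (TypeGNine W ∧ TypeGNine V) ∧
      padicValInt 3 W.minimalDiscriminantInt =
        (if padicValInt 3 V.minimalDiscriminantInt ≤ 6 then padicValInt 3 V.minimalDiscriminantInt + 6
          else padicValInt 3 V.minimalDiscriminantInt - 6) ∧
      ((krausInertiaOrderThree V = 3 ∧ krausInertiaOrderThree W = 6) ∨
        (krausInertiaOrderThree V = 6 ∧ krausInertiaOrderThree W = 3)) ∧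
      W.rootNumberThree = -V.rootNumberThree ∧ W.conductorNorm ℤ = V.conductorNorm ℤ := by
  haveI : Fact (Nat.Prime 3) := ⟨Nat.prime_three⟩
  have hd : (-3 : ℤ) = 3 ∨ (-3 : ℤ) = -3 := Or.inr rfl
  obtain ⟨-, hv, hw3, hN⟩ := twist_involution_of_psRow V W hO6 hev hps C hC
  exact ⟨psSurjRow_twist_of_psSurjRow V W hCM hO6 hsurj hev hps hd C hC,
    forall_towerSurj_twist_iff V W 3 (cast_ne_zero_of_pm_three hd) C hC,
    ⟨typeGNine_twist_of_psRow V W hO6 hev hps hd C hC,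
      (GNineConverse.typeGNine_iff_even_and_mod_three_eq_one V hO6).mpr ⟨hev, hps⟩⟩,
    hv, krausInertiaOrderThree_twist_of_cyclic V W hO6 hev hd C hC, hw3, hN⟩

/-- **Every K1/K2 row has a partner row.** For `V` satisfying the antecedent of the cruxes minus the rank
there are a globally minimal `W` and `C` with `C • V^{(−3)} = W`, and `W` again satisfies that antecedent,
with Kraus order exchanged `3 ↔ 6` and `W₃(W) = −W₃(V)` (existence: Néron / *AEC* VIII.8.3; by
`exists_variableChange_twist_symm` the relation is symmetric). [cite: SilvermanAEC2009, VIII.8.3 and X.5 Cor. 5.4]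
[cite: Kraus1990, Théorème (p = 3)] -/
theorem exists_psSurjRow_partner (hCM : ¬ V.HasCM) (hO6 : ClassO6 V 3) (hsurj : Surj V 3)
    (hev : Even (padicValInt 3 V.minimalDiscriminantInt))
    (hps : V.minimalDiscriminantInt / 3 ^ padicValInt 3 V.minimalDiscriminantInt % 3 = 1) :
    ∃ (W : WeierstrassCurve ℚ) (_ : W.IsElliptic) (_ : W.IsGloballyMinimal) (C : VariableChange ℚ),
      C • V.quadraticTwist ((-3 : ℤ) : ℚ) = W ∧
      (¬ W.HasCM ∧ ClassO6 W 3 ∧ Surj W 3 ∧ Even (padicValInt 3 W.minimalDiscriminantInt) ∧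
        W.minimalDiscriminantInt / 3 ^ padicValInt 3 W.minimalDiscriminantInt % 3 = 1) ∧
      ((krausInertiaOrderThree V = 3 ∧ krausInertiaOrderThree W = 6) ∨
        (krausInertiaOrderThree V = 6 ∧ krausInertiaOrderThree W = 3)) ∧
      W.rootNumberThree = -V.rootNumberThree := by
  have hd : (-3 : ℤ) = 3 ∨ (-3 : ℤ) = -3 := Or.inr rfl
  obtain ⟨W, hWell, hWmin, C, hC⟩ := exists_minimal_twist_pm_three V hd
  obtain ⟨hrow, -, -, -, hkraus, hw3, -⟩ := twist_involution_of_psSurjRow V W hCM hO6 hsurj hev hps C hC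
  exact ⟨W, hWell, hWmin, C, hC, hrow, hkraus, hw3⟩

end Binders

end Summit.BirchSwinnertonDyer.BirchSwinnertonDyer.Theorems.PSTwistInvolution
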